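import Summits.ResolutionOfSingularities.ResolutionOfSingularities.Theorems.FrobeniusClosingPatchingRelPerfectDepthPhaseCCarrier
import Summits.ResolutionOfSingularities.ResolutionOfSingularities.Theorems.FrobeniusClosingPatchingRelPerfectDepthLegalDoubleCurve
import Summits.ResolutionOfSingularities.ResolutionOfSingularities.Theorems.FrobeniusClosingPatchingRelPerfectDepthLegalMove
import Literature.AlgebraicGeometry.Resolution.RegularWeakTransformPrime
import Literature.AlgebraicGeometry.Resolution.AlterationsSemiStableCodimTwoBlowupCentre
import Literature.AlgebraicGeometry.Resolution.AlterationsDescentLimit3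
import Literature.AlgebraicGeometry.Resolution.StrictTransformBaseChange
import Literature.AlgebraicGeometry.Resolution.MonomialMarkedIdealsBlowup
import Literature.AlgebraicGeometry.Resolution.MaximalContactPersistence
import Literature.AlgebraicGeometry.Resolution.BlowupsIntegral
import Literature.AlgebraicGeometry.Resolution.NormalCrossingsStrictification
import Literature.AlgebraicGeometry.Resolution.PointBlowupHsFunMono
import Literature.AlgebraicGeometry.Resolution.BlowupDisjointCentreWeights
import HarnessLib

/-!
# Crux `PatchingRelPerfect` (stmt-ResolutionOfSingularities-16161), chain W5.2 — F7(β) d = 2 (β-AX), C-I finish (CE2):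
# THE CARRIER COUNTDOWN — ONE STEP

[OURS · L1 W5.2 · res-L1-w52-lead-1 g6 (res-L1-w52-plan-1 NOTE G11-38 (3) / G11-40 (CE2) «COUNTDOWN — no letters, no game, independent of
T4»)] Replaces the role of NO printed item; NOT a statement of the manuscript under review; fact-free.

SETTING (format-level, as in Lemma R …DepthPhaseCCarrier, applied with `S :=` the residual state): `X` regular Noetherian, `S` a multi-host
state, `G ≤ S.K` a CARRIER — an integral regular hypersurface (order-one generators, effective Cartier) having simple normal crossings with the
member family (`HasSNC (G :: S.𝓔)`) — and the TRACE `J := S.K|_G` a MONOMIAL `monomialIdeal 𝓛` on `Γ := V(G)` in prime divisor ideals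
`𝓟_ζ` of codimension-one points of `Γ`, every codimension-one point of `cosupp J` lying on a member `E ∈ S.𝓔` different from `G` there.
ONE STEP: pick an entry `(𝓟_ζ, a + 1)` of `𝓛`; the centre `W = cl{ι ζ} ⊂ G ∩ E` is a double curve of the snc family `G :: S.𝓔`, hence
regular and normal crossings (`DepthLegal.hasSNCWith_vanishingIdeal_of_two_members`); blow `X` up along `W` (`blowup`), step the state with
weight `ν = 1` (legal by Lemma R (R3)), replace `G` by its strict transform `G′ = τᶜ(G,1)` (again a carrier: Lemma R (R4)); since `W` is a
Cartier divisor ON `Γ`, `π_G : Γ′ → Γ` is an isomorphism and the new trace is `J′ = (π_G)ᶜ(J, 1) = monomialIdeal 𝓛′` with `𝓛′ = 𝓛`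
pulled back and the chosen exponent lowered to `a` (`countdown_step`).  All invariants are re-established on `X′ = Bl_W X`, and
`S.K𝒪_{X′} = 𝓘_exc · S′.K`.  The induction on `Σ exponents` is in …DepthPhaseCCarrierCountdown.

AI-written; AI review is weaker than expert review.

## References
* E. Bierstone, D. Grigoriev, P. Milman, J. Włodarczyk, arXiv:1206.3090, Lemma 3.6.4 (6), §4 Remark (3). [BierstoneGrigorievMilmanWlodarczyk2011]
* J. Kollár, *Lectures on Resolution of Singularities* (2007), (3.111) Steps 1–3. [Kollar2007]
* U. Görtz, T. Wedhorn, *Algebraic Geometry I* (2nd ed. 2020), Prop. 13.91, (13.19). [GortzWedhorn2020]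
-/

-- `Summit.<Summit>.<Sub>.Theorems` with `Sub = Summit` (single-conjunct summit, D-0017)
set_option linter.dupNamespace false

noncomputable section

open CategoryTheory AlgebraicGeometry TopologicalSpace IsLocalRing
open Literature.AlgebraicGeometry.Resolution
open Scheme.IdealSheafData

namespace Summit.ResolutionOfSingularities.ResolutionOfSingularities.Theorems.DepthMultiHost

universe u

namespace MultiHostState

variable {X : Scheme.{u}}

/-! ## §1 Small bookkeeping lemmas -/

/-- A hypersurface with order-one generators on a regular scheme is a regular scheme (Matsumura 14.2). [cite: Matsumura1987, Thm. 14.2] -/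
theorem isRegular_subscheme_of_orderOne (hX : Scheme.IsRegular X) {G : X.IdealSheafData}
    (hGhyp : ∀ x ∈ G.support, ∃ v : X.presheaf.stalk x, stalkIdeal G x = Ideal.span {v} ∧ v ∉ (maximalIdeal (X.presheaf.stalk x)) ^ 2) :
    Scheme.IsRegular G.subscheme := by
  intro s
  rw [isRegularLocalRing_stalk_subscheme_iff]
  haveI : IsRegularLocalRing (X.presheaf.stalk (G.subschemeι.base s)) := hX _
  obtain ⟨v, hv, hv2⟩ := hGhyp _ (subschemeι_apply_mem_support G s)
  have hvm : v ∈ maximalIdeal (X.presheaf.stalk (G.subschemeι.base s)) :=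
    (Ideal.span_singleton_le_iff_mem _).mp (hv ▸ (mem_support_iff_stalkIdeal_le G _).mp (subschemeι_apply_mem_support G s))
  rw [hv]
  exact (IsRegularLocalRing.quotient_span_singleton hvm hv2).1

/-- If the carrier lies in `K` and the trace of `K` on the carrier is the unit ideal, then `K` is the unit ideal. [folklore] -/
theorem eq_top_of_comap_subschemeι_eq_top {G K : X.IdealSheafData} (hGK : G ≤ K) (h : K.comap G.subschemeι = ⊤) : K = ⊤ := by
  rw [← Scheme.IdealSheafData.support_eq_bot_iff, eq_bot_iff]
  intro x hx
  have hxG : x ∈ (G.support : Set X) := support_antitone hGK hx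
  obtain ⟨y, rfl⟩ : x ∈ Set.range G.subschemeι.base := by rw [range_subschemeι]; exact hxG
  have hy : y ∈ ((K.comap G.subschemeι).support : Set G.subscheme) := (mem_support_comap_iff G.subschemeι K y).mpr hx
  rw [h, Scheme.IdealSheafData.support_top] at hy
  exact absurd hy (by simp)

/-- Pulling back a monomial ideal: pull back the members, keep the exponents. [folklore] -/
theorem comap_monomialIdeal_map {Y : Scheme.{u}} (f : X ⟶ Y) (L : List (Y.IdealSheafData × ℕ)) :
    (monomialIdeal L).comap f = monomialIdeal (L.map fun p => (p.1.comap f, p.2)) := by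
  induction L with
  | nil => rw [monomialIdeal_nil, List.map_nil, monomialIdeal_nil, Scheme.IdealSheafData.comap_top]
  | cons p L ih => rw [monomialIdeal_cons, List.map_cons, monomialIdeal_cons, comap_mul, comap_pow, ih]

/-- The total exponent of an exponent list. [folklore] -/
theorem sum_map_snd_append_cons {α : Type*} (L₁ L₂ : List (α × ℕ)) (p : α × ℕ) :
    ((L₁ ++ p :: L₂).map Prod.snd).sum = (L₁.map Prod.snd).sum + p.2 + (L₂.map Prod.snd).sum := by
  simp [List.map_append, List.sum_append, add_assoc]

/-- A codimension-one point of an integral scheme gives a non-zero prime divisor ideal. [folklore] -/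
theorem primeDivisorIdeal_ne_bot {Y : Scheme.{u}} [IsIntegral Y] {ζ : Y} (hζ : Order.coheight ζ = 1) : primeDivisorIdeal ζ ≠ ⊥ := by
  intro h
  have hmem : genericPoint Y ∈ ((primeDivisorIdeal ζ).support : Set Y) := by rw [h, Scheme.IdealSheafData.support_bot]; trivial
  rw [coe_support_primeDivisorIdeal] at hmem
  have hspec : ζ ⤳ genericPoint Y := specializes_iff_mem_closure.mpr hmem
  have heq : ζ = genericPoint Y := (hspec.antisymm ((genericPoint_spec Y).specializes trivial)).eq
  have h0 : Order.coheight ζ = 0 := by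
    rw [heq]; exact Order.coheight_eq_zero.2 fun y _ => Scheme.le_iff_specializes.2 (genericPoint_specializes y)
  rw [h0] at hζ
  exact zero_ne_one hζ

/-- `monomialIdeal (L₁ ++ p :: L₂) ≤ p.1 ^ p.2`. [folklore] -/
theorem monomialIdeal_append_cons_le {Y : Scheme.{u}} (L₁ L₂ : List (Y.IdealSheafData × ℕ)) (p : Y.IdealSheafData × ℕ) :
    monomialIdeal (L₁ ++ p :: L₂) ≤ p.1 ^ p.2 := by
  rw [monomialIdeal_append, monomialIdeal_cons]
  refine Scheme.IdealSheafData.le_def.mpr fun U => ?_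
  rw [Scheme.IdealSheafData.ideal_mul, Pi.mul_apply, Scheme.IdealSheafData.ideal_mul, Pi.mul_apply]
  exact Ideal.mul_le_left.trans Ideal.mul_le_right

/-- `monomialIdeal (L₁ ++ (D, a + 1) :: L₂) = D * monomialIdeal (L₁ ++ (D, a) :: L₂)`. [folklore] -/
theorem monomialIdeal_append_cons_succ {Y : Scheme.{u}} (L₁ L₂ : List (Y.IdealSheafData × ℕ)) (D : Y.IdealSheafData) (a : ℕ) :
    monomialIdeal (L₁ ++ (D, a + 1) :: L₂) = D ^ 1 * monomialIdeal (L₁ ++ (D, a) :: L₂) := by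
  rw [monomialIdeal_append, monomialIdeal_cons, monomialIdeal_append, monomialIdeal_cons, pow_succ, pow_one]
  simp only [mul_comm, mul_left_comm, mul_assoc]

/-- Along an isomorphism the coheight of a point is preserved. [cite: StacksProject, Tag 02OS] -/
theorem coheight_eq_of_isIso {Y Y' : Scheme.{u}} (f : Y' ⟶ Y) [IsIso f] (y' : Y') : Order.coheight y' = Order.coheight (f y') := by
  let e : Y.presheaf.stalk (f y') ≃+* Y'.presheaf.stalk y' := (asIso (f.stalkMap y')).commRingCatIsoToRingEquiv
  have h := ringKrullDim_eq_of_ringEquiv e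
  rw [ringKrullDim_stalk_eq_coheight, ringKrullDim_stalk_eq_coheight] at h
  exact_mod_cast h.symm

/-- Along an isomorphism, prime divisor ideals pull back to prime divisor ideals of codimension-one points. [folklore] -/
theorem exists_comap_primeDivisorIdeal_of_isIso {Y Y' : Scheme.{u}} (f : Y' ⟶ Y) [IsIso f] {ξ : Y} (hξ : Order.coheight ξ = 1) :
    ∃ ξ' : Y', Order.coheight ξ' = 1 ∧ (primeDivisorIdeal ξ).comap f = primeDivisorIdeal ξ' ∧ f ξ' = ξ := by
  have hfξ : f ((inv f) ξ) = ξ := by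
    rw [← Scheme.Hom.comp_apply, IsIso.inv_hom_id]; rfl
  refine ⟨(inv f) ξ, by rw [coheight_eq_of_isIso f, hfξ, hξ], ?_, hfξ⟩
  have h1 := DeJong1996.Descent45.comap_vanishingIdeal_iso (asIso f) ⟨closure {ξ}, isClosed_closure⟩
  rw [asIso_hom] at h1
  rw [primeDivisorIdeal, primeDivisorIdeal, h1]
  congr 1
  apply Closeds.ext
  ext y
  change f y ∈ closure {ξ} ↔ y ∈ closure {(inv f) ξ}
  rw [← specializes_iff_mem_closure, ← specializes_iff_mem_closure]
  constructor
  · intro h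
    have h1 := h.map (inv f).continuous
    have h2 : (inv f) (f y) = y := by rw [← Scheme.Hom.comp_apply, IsIso.hom_inv_id]; rfl
    rwa [h2] at h1
  · intro h
    have h1 := h.map f.continuous
    rwa [hfξ] at h1

/-- [OURS · L1 W5.2] **THE COUNTDOWN STEP** (module docstring): blowing up the double curve `W = cl{ι ζ}` of the chosen entry
`(𝓟_ζ, a + 1)` re-establishes every invariant on `Bl_W X`, lowers the total exponent of the trace by one, and records
`S.K𝒪 = 𝓘_exc · S′.K`. [cite: BierstoneGrigorievMilmanWlodarczyk2011, §4 Remark (3)] [cite: Kollar2007, (3.111) Steps 1–3] -/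
theorem countdown_step [IsNoetherian X] (hX : Scheme.IsRegular X) (S : MultiHostState X) {G : X.IdealSheafData}
    (hGK : G ≤ S.K)
    (hGhyp : ∀ x ∈ G.support, ∃ v : X.presheaf.stalk x, stalkIdeal G x = Ideal.span {v} ∧ v ∉ (maximalIdeal (X.presheaf.stalk x)) ^ 2)
    (hGc : IsEffectiveCartier G) [IsIntegral G.subscheme] (hsnc : HasSNC (G :: S.𝓔))
    (hcov : ∀ ξ : G.subscheme, Order.coheight ξ = 1 → ξ ∈ (S.K.comap G.subschemeι).support →
      ∃ E ∈ S.𝓔, ¬ stalkIdeal E (G.subschemeι ξ) ≤ stalkIdeal G (G.subschemeι ξ) ∧ G.subschemeι ξ ∈ E.support)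
    (𝓛₁ 𝓛₂ : List (G.subscheme.IdealSheafData × ℕ)) {ζ : G.subscheme} (hζ : Order.coheight ζ = 1) (a : ℕ)
    (hJ : S.K.comap G.subschemeι = monomialIdeal (𝓛₁ ++ (primeDivisorIdeal ζ, a + 1) :: 𝓛₂))
    (h𝓛 : ∀ p ∈ 𝓛₁ ++ (primeDivisorIdeal ζ, a + 1) :: 𝓛₂, 0 < p.2 → ∃ ξ : G.subscheme, Order.coheight ξ = 1 ∧ p.1 = primeDivisorIdeal ξ)
    (W : Closeds X) (hWdef : (W : Set X) = closure {G.subschemeι ζ}) :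
    Scheme.IsRegular (vanishingIdeal W).subscheme ∧ ((vanishingIdeal W).support : Set X) ⊆ S.K.support ∧
    ∃ (_ : IsNoetherian (blowup (vanishingIdeal W))) (S' : MultiHostState (blowup (vanishingIdeal W)))
      (G' : (blowup (vanishingIdeal W)).IdealSheafData) (_ : IsIntegral G'.subscheme) (𝓛' : List (G'.subscheme.IdealSheafData × ℕ)),
      Scheme.IsRegular (blowup (vanishingIdeal W)) ∧
      S.K.comap (blowup.π (vanishingIdeal W)) = (vanishingIdeal W).comap (blowup.π (vanishingIdeal W)) * S'.K ∧ S'.n = S.n ∧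
      ((S'.K.support : Set (blowup (vanishingIdeal W))) ⊆ blowup.π (vanishingIdeal W) ⁻¹' (S.K.support : Set X)) ∧
      G' ≤ S'.K ∧
      (∀ x ∈ G'.support, ∃ v : (blowup (vanishingIdeal W)).presheaf.stalk x,
        stalkIdeal G' x = Ideal.span {v} ∧ v ∉ (maximalIdeal ((blowup (vanishingIdeal W)).presheaf.stalk x)) ^ 2) ∧
      IsEffectiveCartier G' ∧ HasSNC (G' :: S'.𝓔) ∧
      (∀ ξ' : G'.subscheme, Order.coheight ξ' = 1 → ξ' ∈ (S'.K.comap G'.subschemeι).support →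
        ∃ E ∈ S'.𝓔, ¬ stalkIdeal E (G'.subschemeι ξ') ≤ stalkIdeal G' (G'.subschemeι ξ') ∧ G'.subschemeι ξ' ∈ E.support) ∧
      S'.K.comap G'.subschemeι = monomialIdeal 𝓛' ∧
      (𝓛'.map Prod.snd).sum + 1 = ((𝓛₁ ++ (primeDivisorIdeal ζ, a + 1) :: 𝓛₂).map Prod.snd).sum ∧
      (∀ p ∈ 𝓛', 0 < p.2 → ∃ ξ : G'.subscheme, Order.coheight ξ = 1 ∧ p.1 = primeDivisorIdeal ξ) := by
  classical
  have hWeq : (⟨closure {G.subschemeι ζ}, isClosed_closure⟩ : Closeds X) = W := (Closeds.ext hWdef).symm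
  haveI : IsLocallyNoetherian G.subscheme := LocallyOfFiniteType.isLocallyNoetherian G.subschemeι
  have hGreg : Scheme.IsRegular G.subscheme := isRegular_subscheme_of_orderOne hX hGhyp
  haveI : IsRegularLocalRing (X.presheaf.stalk (G.subschemeι ζ)) := hX _
  have hx₀G : G.subschemeι ζ ∈ G.support := subschemeι_apply_mem_support G ζ
  obtain ⟨z, hDz, hz2⟩ := hGhyp _ hx₀G
  have hγ : Order.coheight (G.subschemeι ζ) = 2 := DepthLegal.coheight_subschemeι_eq_two ζ hζ hDz hz2
  -- `ζ ∈ cosupp J`, the member `E` through `x₀`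
  have hζJ : ζ ∈ (S.K.comap G.subschemeι).support := by
    have hle : S.K.comap G.subschemeι ≤ primeDivisorIdeal ζ := by
      rw [hJ]
      refine (monomialIdeal_append_cons_le 𝓛₁ 𝓛₂ _).trans ?_
      rw [pow_succ]
      exact Scheme.IdealSheafData.le_def.mpr fun U => by
        rw [Scheme.IdealSheafData.ideal_mul, Pi.mul_apply]; exact Ideal.mul_le_left
    refine support_antitone hle ?_
    show ζ ∈ ((primeDivisorIdeal ζ).support : Set G.subscheme)
    rw [coe_support_primeDivisorIdeal]; exact subset_closure rfl
  obtain ⟨E, hE, hEG, hx₀E⟩ := hcov ζ hζ hζJ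
  have hne : G ≠ E := fun h => hEG (h ▸ le_rfl)
  -- the centre: a double curve of the snc family `G :: S.𝓔`
  have hW : HasSNCWith (G :: S.𝓔) (vanishingIdeal W) := by
    rw [← hWeq]
    exact DepthLegal.hasSNCWith_vanishingIdeal_of_two_members hsnc List.mem_cons_self (List.mem_cons_of_mem _ hE) hne hγ hx₀G hx₀E
  have hW𝓔 : HasSNCWith S.𝓔 (vanishingIdeal W) := hW.sublist (List.sublist_cons_self _ _)
  have hWreg : Scheme.IsRegular (vanishingIdeal W).subscheme := hW.isRegular_subscheme
  have hx₀K : G.subschemeι ζ ∈ S.K.support := (mem_support_comap_iff G.subschemeι S.K ζ).mp hζJ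
  have hWK : (W : Set X) ⊆ S.K.support := by
    rw [hWdef]; exact closure_minimal (Set.singleton_subset_iff.mpr hx₀K) S.K.support.isClosed
  have hCsupp : ((vanishingIdeal W).support : Set X) ⊆ S.K.support := by
    rw [Scheme.IdealSheafData.coe_support_vanishingIdeal]; exact hWK
  have hη : IsGenericPoint (G.subschemeι ζ) (W : Set X) := by rw [hWdef]; exact isGenericPoint_closure
  have hGC : G ≤ vanishingIdeal W := S.carrier_le_vanishingIdeal hGK hWK
  -- the blowing up and the stepped state
  have hτ := blowup.isBlowup (vanishingIdeal W)
  haveI hN' : IsNoetherian (blowup (vanishingIdeal W)) := isNoetherian_of_isBlowup hτ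
  haveI : IsLocallyNoetherian (controlledTransform (blowup.π (vanishingIdeal W)) (vanishingIdeal W) G 1).subscheme :=
    LocallyOfFiniteType.isLocallyNoetherian (controlledTransform (blowup.π (vanishingIdeal W)) (vanishingIdeal W) G 1).subschemeι
  let m : Fin S.n → ℕ := fun i => if S.host i ≤ vanishingIdeal W then 1 else 0
  have hA : ∀ i, S.host i ≤ vanishingIdeal W ^ m i := by
    intro i
    by_cases h : S.host i ≤ vanishingIdeal W
    · simp only [m, if_pos h, pow_one]; exact h
    · simp only [m, if_neg h, pow_zero, Scheme.IdealSheafData.one_eq_top]; exact le_top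
  have hν : ∀ i, 1 ≤ m i + weightAt (S.exps i) (G.subschemeι ζ) :=
    S.one_le_add_weightAt hWK hη (m := m) fun i h => by simp only [m, if_pos h]; exact le_rfl
  -- Lemma R facts
  have hK := S.comap_K_eq_pow_mul_K_step (blowup.π _) W (G.subschemeι ζ) m 1 hW𝓔 hτ hη hA hν
  rw [pow_one] at hK
  have hG'K := S.carrier_step_le_K (hsnc := hW𝓔) (hτ := hτ) hGK hη hA hν
  have hG'hyp := S.carrier_step_hyp hX hGK hGhyp hWK hWreg hτ
  have hG'c := S.carrier_step_isEffectiveCartier hGK hWK hτ hGc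
  have hX' : Scheme.IsRegular (blowup (vanishingIdeal W)) := step_isRegular hX hWreg hτ
  have hst : strictTransformIdeal (blowup.π (vanishingIdeal W)) (vanishingIdeal W) G =
      controlledTransform (blowup.π (vanishingIdeal W)) (vanishingIdeal W) G 1 :=
    hτ.strictTransformIdeal_eq_controlledTransform_of_isRegular_subscheme hX hWreg hGC hGreg
  -- the carrier map `π_G`, an isomorphism
  obtain ⟨πG, hπG⟩ := exists_carrier_hom (blowup.π (vanishingIdeal W)) W G
  have hπGb := S.isBlowup_carrier hX hGK hGhyp hWK hWreg hτ πG hπG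
  have hCι : (vanishingIdeal W).comap G.subschemeι = primeDivisorIdeal ζ := by
    rw [← hWeq]; exact DepthLegal.comap_subschemeι_vanishingIdeal_closure ζ
  rw [hCι] at hπGb
  haveI : IsIso πG := hπGb.isIso (isEffectiveCartier_primeDivisorIdeal_of_isRegular hGreg hζ)
  haveI : IsIntegral (controlledTransform (blowup.π (vanishingIdeal W)) (vanishingIdeal W) G 1).subscheme :=
    hπGb.isIntegral (primeDivisorIdeal_ne_bot hζ)
  -- the new trace
  have hJ' := S.comap_carrier_K_step hX hGK hGhyp hWK hWreg (hsnc := hW𝓔) hτ hη hA hν πG hπG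
  rw [hCι, hJ] at hJ'
  let pb : G.subscheme.IdealSheafData × ℕ →
      (controlledTransform (blowup.π (vanishingIdeal W)) (vanishingIdeal W) G 1).subscheme.IdealSheafData × ℕ :=
    fun p => (p.1.comap πG, p.2)
  have hJ'eq : (S.step (blowup.π (vanishingIdeal W)) W (G.subschemeι ζ) m 1 hW𝓔 hτ).K.comap
      (controlledTransform (blowup.π (vanishingIdeal W)) (vanishingIdeal W) G 1).subschemeι =
      monomialIdeal (𝓛₁.map pb ++ ((primeDivisorIdeal ζ).comap πG, a) :: 𝓛₂.map pb) := by
    rw [hJ']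
    unfold controlledTransform
    rw [comap_monomialIdeal_map, List.map_append, List.map_cons]
    change colon (monomialIdeal (𝓛₁.map pb ++ ((primeDivisorIdeal ζ).comap πG, a + 1) :: 𝓛₂.map pb))
      ((primeDivisorIdeal ζ).comap πG ^ 1) = _
    rw [monomialIdeal_append_cons_succ]
    exact colon_pow_mul_eq hπGb.isEffectiveCartier _ 1
  refine ⟨hWreg, hCsupp, hN', S.step (blowup.π (vanishingIdeal W)) W (G.subschemeι ζ) m 1 hW𝓔 hτ,
    controlledTransform (blowup.π (vanishingIdeal W)) (vanishingIdeal W) G 1, ‹_›,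
    𝓛₁.map pb ++ ((primeDivisorIdeal ζ).comap πG, a) :: 𝓛₂.map pb, hX', hK, rfl, ?_, hG'K, hG'hyp, hG'c, ?_, ?_, hJ'eq, ?_, ?_⟩
  · -- cosupports
    intro x' hx'
    have h1 : x' ∈ ((S.K.comap (blowup.π (vanishingIdeal W))).support : Set (blowup (vanishingIdeal W))) := by
      refine support_antitone ?_ hx'
      rw [hK]
      exact Scheme.IdealSheafData.le_def.mpr fun U => by
        rw [Scheme.IdealSheafData.ideal_mul, Pi.mul_apply]; exact Ideal.mul_le_left
    exact (mem_support_comap_iff _ S.K x').mp h1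
  · -- `G′ :: 𝓔′` snc
    have h := hW.hasSNC_transform hτ
    rw [List.map_cons, List.cons_append, hst] at h
    exact h
  · -- the cover clause on `Γ′`
    intro ξ' hξ' hξ'J
    have hξ : Order.coheight (πG ξ') = 1 := by rw [← coheight_eq_of_isIso πG, hξ']
    have hξJ : πG ξ' ∈ (S.K.comap G.subschemeι).support := by
      have h1 : ((S.step (blowup.π (vanishingIdeal W)) W (G.subschemeι ζ) m 1 hW𝓔 hτ).K.comap (controlledTransform
          (blowup.π (vanishingIdeal W)) (vanishingIdeal W) G 1).subschemeι).support ≤ ((S.K.comap G.subschemeι).comap πG).support := by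
        rw [hJ', ← hJ]
        exact support_antitone (comap_le_controlledTransform πG _ _ 1)
      exact (mem_support_comap_iff πG _ ξ').mp (h1 hξ'J)
    obtain ⟨E₁, hE₁, hE₁G, hξE₁⟩ := hcov (πG ξ') hξ hξJ
    -- `τ (ι′ ξ′) = ι (π_G ξ′)`
    have hsq : blowup.π (vanishingIdeal W) ((controlledTransform (blowup.π (vanishingIdeal W)) (vanishingIdeal W) G 1).subschemeι ξ') =
        G.subschemeι (πG ξ') := by
      rw [← Scheme.Hom.comp_apply, ← hπG, Scheme.Hom.comp_apply]
    have hx'G : (controlledTransform (blowup.π (vanishingIdeal W)) (vanishingIdeal W) G 1).subschemeι ξ' ∈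
        (controlledTransform (blowup.π (vanishingIdeal W)) (vanishingIdeal W) G 1).support := subschemeι_apply_mem_support _ ξ'
    by_cases hmem : G.subschemeι (πG ξ') ∈ (W : Set X)
    · -- over the centre: the exceptional member
      refine ⟨(vanishingIdeal W).comap (blowup.π (vanishingIdeal W)), List.mem_append_right _ (List.mem_singleton_self _), ?_, ?_⟩
      · exact not_stalkIdeal_le_of_isEffectiveCartier_comap_subschemeι
          (hτ.isEffectiveCartier_comap_subschemeι_controlledTransform hX hWreg hGC hGhyp) hx'G
      · rw [← SetLike.mem_coe, mem_support_comap_iff, hsq, Scheme.IdealSheafData.coe_support_vanishingIdeal]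
        exact hmem
    · -- off the centre: the strict transform of `E₁`; `τ` is a local isomorphism there
      have hE₁G' : ¬ stalkIdeal E₁ (blowup.π (vanishingIdeal W) ((controlledTransform (blowup.π (vanishingIdeal W)) (vanishingIdeal W)
          G 1).subschemeι ξ')) ≤ stalkIdeal G (blowup.π (vanishingIdeal W) ((controlledTransform (blowup.π (vanishingIdeal W))
          (vanishingIdeal W) G 1).subschemeι ξ')) := hsq ▸ hE₁G
      have hξE₁' : blowup.π (vanishingIdeal W) ((controlledTransform (blowup.π (vanishingIdeal W)) (vanishingIdeal W) G 1).subschemeι ξ')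
          ∈ E₁.support := hsq ▸ hξE₁
      have hnot : blowup.π (vanishingIdeal W) ((controlledTransform (blowup.π (vanishingIdeal W)) (vanishingIdeal W) G 1).subschemeι ξ')
          ∉ closure {G.subschemeι ζ} := by rw [← hWdef, hsq]; exact hmem
      have hnotC : blowup.π (vanishingIdeal W) ((controlledTransform (blowup.π (vanishingIdeal W)) (vanishingIdeal W) G 1).subschemeι ξ')
          ∉ (vanishingIdeal W).support := by
        rw [← SetLike.mem_coe, Scheme.IdealSheafData.coe_support_vanishingIdeal, hsq]; exact hmem
      have hτ' : IsBlowup (blowup.π (vanishingIdeal W)) (vanishingIdeal ⟨closure {G.subschemeι ζ}, isClosed_closure⟩) := by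
        rw [hWeq]; exact hτ
      haveI hiso := hτ'.isIso_stalkMap_of_notMem_closure hnot
      have hbij : Function.Bijective ((blowup.π (vanishingIdeal W)).stalkMap
          ((controlledTransform (blowup.π (vanishingIdeal W)) (vanishingIdeal W) G 1).subschemeι ξ')).hom :=
        ConcreteCategory.bijective_of_isIso _
      have hstE := stalkIdeal_strictTransformIdeal_of_not_mem_support (vanishingIdeal W) E₁ hnotC
      have hstG := stalkIdeal_strictTransformIdeal_of_not_mem_support (vanishingIdeal W) G hnotC
      rw [hst] at hstG
      refine ⟨strictTransformIdeal (blowup.π (vanishingIdeal W)) (vanishingIdeal W) E₁,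
        List.mem_append_left _ (List.mem_map.mpr ⟨E₁, hE₁, rfl⟩), ?_, ?_⟩
      · intro hle
        rw [hstE, hstG] at hle
        apply hE₁G'
        have h2 := Ideal.comap_mono (f := ((blowup.π (vanishingIdeal W)).stalkMap _).hom) hle
        rwa [Ideal.comap_map_of_bijective _ hbij, Ideal.comap_map_of_bijective _ hbij] at h2
      · rw [mem_support_iff_stalkIdeal_le, hstE]
        apply IsLocalRing.le_maximalIdeal
        intro htop
        have h2 := congrArg (Ideal.comap ((blowup.π (vanishingIdeal W)).stalkMap _).hom) htop
        rw [Ideal.comap_map_of_bijective _ hbij, Ideal.comap_top] at h2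
        have h3 := (mem_support_iff_stalkIdeal_le E₁ _).mp hξE₁'
        rw [h2] at h3
        exact (maximalIdeal.isMaximal _).ne_top (top_le_iff.mp h3)
  · -- total exponent
    have hsnd : ∀ L : List (G.subscheme.IdealSheafData × ℕ), (L.map pb).map Prod.snd = L.map Prod.snd := by
      intro L; rw [List.map_map]; rfl
    rw [sum_map_snd_append_cons, sum_map_snd_append_cons, hsnd, hsnd]
    simp only
    omega
  · -- structure of `𝓛′`
    intro p hp hp0
    have hcase : (∃ q ∈ 𝓛₁ ++ (primeDivisorIdeal ζ, a + 1) :: 𝓛₂, 0 < q.2 ∧ p.1 = q.1.comap πG) := by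
      rcases List.mem_append.mp hp with h | h
      · obtain ⟨q, hq, rfl⟩ := List.mem_map.mp h
        exact ⟨q, List.mem_append_left _ hq, hp0, rfl⟩
      · rcases List.mem_cons.mp h with rfl | h
        · exact ⟨(primeDivisorIdeal ζ, a + 1), List.mem_append_right _ List.mem_cons_self, Nat.succ_pos a, rfl⟩
        · obtain ⟨q, hq, rfl⟩ := List.mem_map.mp h
          exact ⟨q, List.mem_append_right _ (List.mem_cons_of_mem _ hq), hp0, rfl⟩
    obtain ⟨q, hq, hq0, hpq⟩ := hcase
    obtain ⟨ξ, hξ, hqξ⟩ := h𝓛 q hq hq0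
    obtain ⟨ξ', hξ', hcomap, -⟩ := exists_comap_primeDivisorIdeal_of_isIso πG hξ
    exact ⟨ξ', hξ', by rw [hpq, hqξ, hcomap]⟩

end MultiHostState

end Summit.ResolutionOfSingularities.ResolutionOfSingularities.Theorems.DepthMultiHost

end
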